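import Summits.QuantumFields.YangMills.Theorems.BalabanUVNodesN15TwoSpacingGluingCurvedKnitSmallFieldCovariantGradient
import Summits.QuantumFields.YangMills.Theorems.BalabanUVNodesN15TwoSpacingGluingCurvedKnitSmallFieldCovariantAdjoint
import Summits.QuantumFields.YangMills.Theorems.BalabanUVNodesN15TwoSpacingGluingCurvedKnitSmallFieldNodeTwo
import HarnessLib

/-!
# (∇4-adj) `T4EtaRate.NE2PlusOperator` BY NAME FOR THE LIVE-BACKGROUND GLUED FAMILY WITH ALL FOUR ENTRIES OF (3.42) CONSTRUCTED, ENTRY 2 = THE PRINT's `𝒢∇*_U` — the covariant FORWARD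
# gradient `D^η_{R⁺_{μ₁}}𝒢` (FILE 144) in slot 1 and the RIGHT-COMPOSED covariant backward derivative `𝒢∘D^η_{R⁻_{μ₂}}` (n15-c∕179, the adjoint arrangement) in slot 2; entry 0 (130), entry 3 (134)
# (dag-n15-c g20, n15-c∕180 — FILE 145's text with slot 2 re-pinned; N15 = NE2, s1 road (c) «print-faithful non-abelian G(U)»)

Cell `pub-ymgap`, seat `pub-ymgap-dag-n15-c` (R134 (a); HUMAN RULING D-0062), generation 20.  `bears_on: R4∕N15 · K3⁸ SpineGivenEndpointR13SepCoPHV (stmt-QuantumFields-27366)`.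
Filed `--kind proof --supports stmt-QuantumFields-27366 --as helper` — COUNT-NEUTRAL.  Theorems only; 0 `def`, 0 `sorry`.  Imports BY NAME FILE 144 `…CurvedKnitSmallFieldCovariantGradient`
(`sf_idef_covD_cvGlued`), n15-c∕179 `…CurvedKnitSmallFieldCovariantAdjoint` (`sf_idef_bgradCov_cvGlued`) and FILE 135 `…CurvedKnitSmallFieldNodeTwo` (`ne2PlusOperator_sf₃`; through it 132, 131,
134, 130).  FILE 145's text with slot 2 re-pinned to the adjoint entry and the rate exponent `γ = 1∕(16(d+1))`; nothing in the tree is modified.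

WHAT.  ★★★ `ne2PlusOperator_sf₄_adj` — for directions `μ₁, μ₂`, if the consumer's `E i 1` is the η-defect of the covariant forward gradient `D^{η′}_{R′⁺_{μ₁}}𝒢′` vs `D^η_{R⁺_{μ₁}}𝒢`, `E i 2` the
η-defect of the ADJOINT entry `𝒢′∘D^{η′}_{R′⁻_{μ₂}}` vs `𝒢∘D^η_{R⁻_{μ₂}}` (n15-b `covD η (gaugePair τ S (inr μ₂)) (τ μ₂)⁻¹` RIGHT-composed — for unitary transports `(∇_U)* = −∇_U^{bwd}`, the
print's `G∇*_U`), and `E i 3` the Laplacian η-defect, then `NE2PlusOperator c₃₅ (sfInstance d mm ι hL) (fun i => sfFamily d mm ι a e hL i (E i))` — ALL FOUR ENTRIES OF (3.42) CONSTRUCTED AND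
PROVED for the model family, `M = L^m` LIVE, hypotheses = `L ≥ 7` odd, `a, c₃₅ > 0`, trace-form-orthonormal `e` only.  Rate exponent `γ = 1∕(16(d+1))` (the adjoint entry's two-grid letter
carries `(L^k)^{−1∕(8(d+1))}` from the right-entry defects of dag-n15-a's images cubes).

HONEST FRAMING ∕ LIMITS.  Bookkeeping over LANDED theorems; MODEL family (global small-field gauge = (3.35) with `u ≡ 1`; covariant Laplacian (3.50) ⊗ colour + FLAT nonlocal part (1.69) —
NOT Bałaban's `Δ_a(U)` (3.26); C² window incl. all mixed second differences; King-block-mean pairing; doubled-torus cover); the η-RATE inequality is NOT PRINTED ([B9] Thm 3.14 = domain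
differences); nothing of [B5]∕[B6]∕[B9] asserted.  NE2⁺ for THIS model family only — NOT the record's K3⁸ socket; NE2 for non-abelian `G(U)` as printed NOT proved; N15 of record untouched
(№253) — road (c)'s bookkeeping, NO count; K3⁸ skeleton untouched; one finite 𝕋⁴ at fixed ε — NOT infinite volume, NOT OS on ℝ⁴, NOT a mass gap, NOT Clay.  Restate-immune (no Theses import).
-/

noncomputable section

open scoped BigOperators Matrix Matrix.Norms.Frobenius

namespace Summit.QuantumFields.YangMills.BalabanUVNodes.N15.Gluing

open Literature.MathematicalPhysics.QuantumFieldTheory.Balaban1983to89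
open Literature.MathematicalPhysics.QuantumFieldTheory.Balaban1983to89.B11SectG (BlockNorm HasMaj)
open Literature.MathematicalPhysics.QuantumFieldTheory.Balaban1983to89.T4EtaRate (NE2PlusOperator rateFactor)
open Literature.MathematicalPhysics.QuantumFieldTheory.Balaban1983to89.T4EtaRateDefect (idef)
open Literature.MathematicalPhysics.QuantumFieldTheory.Balaban1983to89.T4EtaRateCoeffDefect (pull)
open Literature.MathematicalPhysics.QuantumFieldTheory.Balaban1983to89.B6UnitTorusCarrier (unitTorusGeo)
open Literature.Barriers.QuantumFields (traceForm)
open Summit.QuantumFields.YangMills.BalabanUVNodes.N15.BackgroundLayer (covLapM gavgM fgrad bgrad)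
open Summit.QuantumFields.YangMills.BalabanUVNodes.N15.VectorPiece (bshiftEquiv kingPrV)
open Summit.QuantumFields.YangMills.BalabanUVNodes.N15.MatrixSpecies (coordMat liftBlk liftMap liftEquiv basisConst basisConst_nonneg covD)
open Summit.QuantumFields.YangMills.BalabanUVNodes.N15.OperatorReadout (opGeo opGeo_len pref4_pos)
open Summit.QuantumFields.YangMills.BalabanUVNodes.N15.CurvedSpecies (gaugePair)

variable (d : ℕ) {L : ℕ} [NeZero L] (mm ι : Type) [Fintype mm] [DecidableEq mm] [Fintype ι] [DecidableEq ι] (e : Matrix mm mm ℂ ≃L[ℝ] (ι → ℝ))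

set_option maxHeartbeats 800000 in
/-- ★★★ **NE2⁺, OPERATOR LAYER, BY NAME, FOR THE LIVE-BACKGROUND GLUED FAMILY — ALL FOUR ENTRIES OF (3.42), ENTRY 2 IN THE ADJOINT ARRANGEMENT `𝒢∘∇^{U*}`.**  For odd `L ≥ 7`, `a > 0`,
`c₃₅ > 0`, trace-form-orthonormal `e`, directions `μ₁, μ₂`: if `E i 1` is the η-defect of the covariant forward gradient `D^η_{R⁺_{μ₁}}𝒢` of the live glued pair, `E i 2` the η-defect of
`𝒢∘D^η_{R⁻_{μ₂}}` (the glued propagator right-composed with the covariant backward derivative along `τ_{μ₂}⁻¹`) and `E i 3` the η-defect `𝔇_π̂(Δ′_{U′}G′, Δ_UG)`, then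
`NE2PlusOperator c₃₅ (sfInstance d mm ι hL) (fun i => sfFamily d mm ι a e hL i (E i))` — entry 0 (FILE 130), entry 1 (FILE 144), entry 2 (n15-c∕179), entry 3 (FILE 134), NO displayed
majorant hypothesis.  MODEL family; NOT [B9] Thm 3.1∕3.14 as printed.
[cite: Balaban1985BackgroundPropagators, Thm 3.1 p.397 (quantifier template, (3.42): the four entries, `∇_UG`, `G∇*_U`), (3.50)–(3.53) p.400, (3.64)–(3.65) pp.402–403, Thm 3.14 pp.426–427 (difference template), (3.35)–(3.36) p.396; King1986, Prop. 3.9 (3.73) p.665 (rate factor); Balaban1984PropagatorsII, (2.91)–(2.93) p.239] -/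
theorem ne2PlusOperator_sf₄_adj (hL : Odd L ∧ 1 < L) (hL7 : 7 ≤ L) {a : ℝ} (ha : 0 < a) {c35 : ℝ} (hc35 : 0 < c35) (he : ∀ A B : Matrix mm mm ℂ, traceForm A B = e A ⬝ᵥ e B)
    (μ₁ μ₂ : Fin (d + 1))
    (E : ∀ i : SfIdx d L, Fin 4 → (Fin (d + 1) → CvX' d L i.m i.kk i.r hL → Matrix mm mm ℂ) → ((CvX d L i.m i.kk hL × ι → ℝ) →ₗ[ℝ] (CvX' d L i.m i.kk i.r hL × ι → ℝ)))
    (hE1 : ∀ (i : SfIdx d L) (A' : Fin (d + 1) → CvX' d L i.m i.kk i.r hL → Matrix mm mm ℂ), E i 1 A' =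
      idef (pull (liftMap (kingPrV L i.kk i.r (cvM d L i.m i.kk hL)) ι)) (pull (liftMap (kingPrV L i.kk i.r (cvM d L i.m i.kk hL)) ι))
        (covD ((((L ^ i.r * L ^ i.kk : ℕ) : ℝ))⁻¹) (gaugePair (bshiftEquiv (cvM d L i.m i.kk hL) (L ^ i.r * L ^ i.kk)) (fun μ x' => coordMat e (ContinuousLinearMap.mulLeftRight ℝ (Matrix mm mm ℂ) (NormedSpace.exp (((((L ^ i.r * L ^ i.kk : ℕ) : ℝ))⁻¹) • A' μ x')) (NormedSpace.exp (((((L ^ i.r * L ^ i.kk : ℕ) : ℝ))⁻¹) • A' μ x'))ᴴ)) (Sum.inl μ₁)) (bshiftEquiv (cvM d L i.m i.kk hL) (L ^ i.r * L ^ i.kk) μ₁) ∘ₗ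
          cvGlued' d L i.m i.kk i.r hL a ((((L ^ i.r * L ^ i.kk : ℕ) : ℝ))⁻¹) ι e (fun _ _ => (1 : Matrix mm mm ℂ)) (fun μ x' => NormedSpace.exp (((((L ^ i.r * L ^ i.kk : ℕ) : ℝ))⁻¹) • A' μ x')) (cvNL' d L i.m i.kk i.r hL a ι) (fun _ => 0))
        (covD ((((L ^ i.kk : ℕ) : ℝ))⁻¹) (gaugePair (bshiftEquiv (cvM d L i.m i.kk hL) (L ^ i.kk)) (fun μ x => coordMat e (ContinuousLinearMap.mulLeftRight ℝ (Matrix mm mm ℂ) (NormedSpace.exp (((((L ^ i.kk : ℕ) : ℝ))⁻¹) • gavgM (Matrix mm mm ℂ) (Fin (d + 1)) (kingPrV L i.kk i.r (cvM d L i.m i.kk hL)) A' μ x)) (NormedSpace.exp (((((L ^ i.kk : ℕ) : ℝ))⁻¹) • gavgM (Matrix mm mm ℂ) (Fin (d + 1)) (kingPrV L i.kk i.r (cvM d L i.m i.kk hL)) A' μ x))ᴴ)) (Sum.inl μ₁)) (bshiftEquiv (cvM d L i.m i.kk hL) (L ^ i.kk) μ₁) ∘ₗ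
          cvGlued d L i.m i.kk hL a ((((L ^ i.kk : ℕ) : ℝ))⁻¹) ι e (fun _ _ => (1 : Matrix mm mm ℂ)) (fun μ x => NormedSpace.exp (((((L ^ i.kk : ℕ) : ℝ))⁻¹) • gavgM (Matrix mm mm ℂ) (Fin (d + 1)) (kingPrV L i.kk i.r (cvM d L i.m i.kk hL)) A' μ x)) (cvNL d L i.m i.kk hL a ι) (fun _ => 0)))
    (hE2 : ∀ (i : SfIdx d L) (A' : Fin (d + 1) → CvX' d L i.m i.kk i.r hL → Matrix mm mm ℂ), E i 2 A' =
      idef (pull (liftMap (kingPrV L i.kk i.r (cvM d L i.m i.kk hL)) ι)) (pull (liftMap (kingPrV L i.kk i.r (cvM d L i.m i.kk hL)) ι))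
            ((cvGlued' d L i.m i.kk i.r hL a ((((L ^ i.r * L ^ i.kk : ℕ) : ℝ))⁻¹) ι e (fun _ _ => (1 : Matrix mm mm ℂ)) (fun μ x' => NormedSpace.exp (((((L ^ i.r * L ^ i.kk : ℕ) : ℝ))⁻¹) • A' μ x')) (cvNL' d L i.m i.kk i.r hL a ι) (fun _ => 0)) ∘ₗ covD ((((L ^ i.r * L ^ i.kk : ℕ) : ℝ))⁻¹) ((gaugePair (bshiftEquiv (cvM d L i.m i.kk hL) (L ^ i.r * L ^ i.kk)) (fun μ x' => coordMat e (ContinuousLinearMap.mulLeftRight ℝ (Matrix mm mm ℂ) (NormedSpace.exp (((((L ^ i.r * L ^ i.kk : ℕ) : ℝ))⁻¹) • A' μ x')) (NormedSpace.exp (((((L ^ i.r * L ^ i.kk : ℕ) : ℝ))⁻¹) • A' μ x'))ᴴ))) (Sum.inr μ₂)) ((bshiftEquiv (cvM d L i.m i.kk hL) (L ^ i.r * L ^ i.kk)) μ₂).symm)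
            ((cvGlued d L i.m i.kk hL a ((((L ^ i.kk : ℕ) : ℝ))⁻¹) ι e (fun _ _ => (1 : Matrix mm mm ℂ)) (fun μ x => NormedSpace.exp (((((L ^ i.kk : ℕ) : ℝ))⁻¹) • gavgM (Matrix mm mm ℂ) (Fin (d + 1)) (kingPrV L i.kk i.r (cvM d L i.m i.kk hL)) A' μ x)) (cvNL d L i.m i.kk hL a ι) (fun _ => 0)) ∘ₗ covD ((((L ^ i.kk : ℕ) : ℝ))⁻¹) ((gaugePair (bshiftEquiv (cvM d L i.m i.kk hL) (L ^ i.kk)) (fun μ x => coordMat e (ContinuousLinearMap.mulLeftRight ℝ (Matrix mm mm ℂ) (NormedSpace.exp (((((L ^ i.kk : ℕ) : ℝ))⁻¹) • gavgM (Matrix mm mm ℂ) (Fin (d + 1)) (kingPrV L i.kk i.r (cvM d L i.m i.kk hL)) A' μ x)) (NormedSpace.exp (((((L ^ i.kk : ℕ) : ℝ))⁻¹) • gavgM (Matrix mm mm ℂ) (Fin (d + 1)) (kingPrV L i.kk i.r (cvM d L i.m i.kk hL)) A' μ x))ᴴ))) (Sum.inr μ₂)) ((bshiftEquiv (cvM d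 L i.m i.kk hL) (L ^ i.kk)) μ₂).symm))
    (hE3 : ∀ (i : SfIdx d L) (A' : Fin (d + 1) → CvX' d L i.m i.kk i.r hL → Matrix mm mm ℂ), E i 3 A' =
      idef (pull (liftMap (kingPrV L i.kk i.r (cvM d L i.m i.kk hL)) ι)) (pull (liftMap (kingPrV L i.kk i.r (cvM d L i.m i.kk hL)) ι)) ((covLapM (bshiftEquiv (cvM d L i.m i.kk hL) (L ^ i.r * L ^ i.kk)) ((((L ^ i.r * L ^ i.kk : ℕ) : ℝ))⁻¹) (gaugePair (bshiftEquiv (cvM d L i.m i.kk hL) (L ^ i.r * L ^ i.kk)) (fun μ x' => coordMat e (ContinuousLinearMap.mulLeftRight ℝ (Matrix mm mm ℂ) (NormedSpace.exp (((((L ^ i.r * L ^ i.kk : ℕ) : ℝ))⁻¹) • A' μ x')) (NormedSpace.exp (((((L ^ i.r * L ^ i.kk : ℕ) : ℝ))⁻¹) • A' μ x'))ᴴ)))) ∘ₗ (cvGlued' d L i.m i.kk i.r hL a ((((L ^ i.r * L ^ i.kk : ℕ) : ℝ))⁻¹) ι e (fun _ _ => (1 : Matrix mm mm ℂ)) (fun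 μ x' => NormedSpace.exp (((((L ^ i.r * L ^ i.kk : ℕ) : ℝ))⁻¹) • A' μ x')) (cvNL' d L i.m i.kk i.r hL a ι) (fun _ => 0))) ((covLapM (bshiftEquiv (cvM d L i.m i.kk hL) (L ^ i.kk)) ((((L ^ i.kk : ℕ) : ℝ))⁻¹) (gaugePair (bshiftEquiv (cvM d L i.m i.kk hL) (L ^ i.kk)) (fun μ x => coordMat e (ContinuousLinearMap.mulLeftRight ℝ (Matrix mm mm ℂ) (NormedSpace.exp (((((L ^ i.kk : ℕ) : ℝ))⁻¹) • gavgM (Matrix mm mm ℂ) (Fin (d + 1)) (kingPrV L i.kk i.r (cvM d L i.m i.kk hL)) A' μ x)) (NormedSpace.exp (((((L ^ i.kk : ℕ) : ℝ))⁻¹) • gavgM (Matrix mm mm ℂ) (Fin (d + 1)) (kingPrV L i.kk i.r (cvM d L i.m i.kk hL)) A' μ x))ᴴ)))) ∘ₗ (cvGlued d L i.m i.kk hL a ((((L ^ i.kk : ℕ) : ℝ))⁻¹) ι e (fun _ _ => (1 : Matrix mm mm ℂ)) (fun μ x => NormedSpace.exp (((((L ^ i.kk : ℕ) : ℝ))⁻¹)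 • gavgM (Matrix mm mm ℂ) (Fin (d + 1)) (kingPrV L i.kk i.r (cvM d L i.m i.kk hL)) A' μ x)) (cvNL d L i.m i.kk hL a ι) (fun _ => 0)))) :
    NE2PlusOperator c35 (sfInstance d mm ι hL) (fun i => sfFamily d mm ι a e hL i (E i)) := by
  obtain ⟨δ, w₀, R₀, D, hδ, hR₀, H⟩ := sf_idef_covD_cvGlued (d := d) hL hL7 ha ι
  obtain ⟨δ', w₀', R₀', D', hδ', hR₀', H'⟩ := sf_idef_bgradCov_cvGlued (d := d) hL hL7 ha ι
  have hLpos : 0 < L := Nat.pos_of_ne_zero (NeZero.ne L)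
  have hLr : (0 : ℝ) < (L : ℝ) := Nat.cast_pos.mpr hLpos
  have hL1 : (1 : ℝ) ≤ (L : ℝ) := by exact_mod_cast hLpos
  -- the constants of the gradient entries (as 132's entry-0 constants), both defect theorems at once
  have hκ0 : 0 ≤ basisConst e := basisConst_nonneg e
  let σ : ℝ := 14 * Real.exp 1 * (1 + Fintype.card (Fin (d + 1))) * basisConst e * ((1 + Fintype.card (Fin (d + 1))) * (3 + 2 * ((d : ℝ) + 1)))
  have hσ0 : 0 ≤ σ := by positivity
  let JJ : ℝ := 1 + Fintype.card (Fin (d + 1) ⊕ Fin (d + 1))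
  have hJJ0 : 0 ≤ JJ := by positivity
  let W : ℝ := 2 * ((1 + Fintype.card (Fin (d + 1))) * (3 + 2 * ((d : ℝ) + 1)))
  have hW0 : 0 < W := by positivity
  let aW : ℝ := 1 / (W * c35)
  have haW : 0 < aW := by positivity
  let Rm : ℝ := min R₀ R₀'
  have hRm : 0 < Rm := lt_min hR₀ hR₀'
  let aR : ℝ := Rm / (σ * c35 * JJ + 1)
  have haR : 0 < aR := by positivity
  let a₁ : ℝ := min aW aR
  have ha₁ : 0 < a₁ := lt_min haW haR
  have ha₁W : a₁ ≤ aW := min_le_left _ _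
  have ha₁R : a₁ ≤ aR := min_le_right _ _
  let M₁ : ℝ := max (max w₀ w₀') 1
  have hM₁ : 0 < M₁ := lt_of_lt_of_le one_pos (le_max_right _ _)
  let δm : ℝ := min δ δ'
  have hδm : 0 < δm := lt_min hδ hδ'
  let Dm : ℝ := max (max D 0) (max D' 0)
  have hDm0 : 0 ≤ Dm := (le_max_right D 0).trans (le_max_left _ _)
  let B₁ : ℝ := Dm * (2 + σ * (c35 * a₁) * JJ) + 1
  have hB₁ : 0 < B₁ := add_pos_of_nonneg_of_pos (by positivity) one_pos
  have hγ : (0 : ℝ) < 1 / (16 * ((d : ℝ) + 1)) := by positivity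
  refine ne2PlusOperator_sf₃ d mm ι e hL hL7 ha hc35 he E hE3 ⟨M₁, δm, a₁, B₁, 1 / (16 * ((d : ℝ) + 1)), hM₁, hδm, ha₁, hB₁, hγ, fun i hM α₀ hα₀ hMa A' hA' n hn0 hn3 => ?_⟩
  -- the index's scalar facts
  have hw₀ : w₀ ≤ ((L ^ i.m : ℕ) : ℝ) := by push_cast; exact ((le_max_left _ _).trans (le_max_left _ _)).trans hM
  have hw₀' : w₀' ≤ ((L ^ i.m : ℕ) : ℝ) := by push_cast; exact ((le_max_right _ _).trans (le_max_left _ _)).trans hM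
  have hx1 : (1 : ℝ) ≤ (L : ℝ) ^ i.kk := one_le_pow₀ hL1
  have hxpos : (0 : ℝ) < (L : ℝ) ^ i.kk := pow_pos hLr _
  have hcast : (((L ^ i.kk : ℕ) : ℝ)) = (L : ℝ) ^ i.kk := by push_cast; rfl
  have hrf : ∀ y : (sfGeo d hL i).Site, ∀ γ' : ℝ, rateFactor (opGeo (sfGeo d hL i) (CvX d L i.m i.kk hL × ι) (liftBlk (cvBlk d L i.m i.kk hL) ι)) γ' y = ((L : ℝ) ^ i.kk) ^ (-γ') :=
    fun y γ' => sfGeo_rateFactor d hL i _ γ' y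
  have hd1 : (1 : ℝ) ≤ (d : ℝ) + 1 := le_add_of_nonneg_left (Nat.cast_nonneg _)
  have hγ16 : -(1 / 16 : ℝ) ≤ -(1 / (16 * ((d : ℝ) + 1))) := by
    rw [neg_le_neg_iff]; exact one_div_le_one_div_of_le (by norm_num) (by nlinarith only [hd1])
  have hγ8 : -(1 / (8 * ((d : ℝ) + 1))) ≤ -(1 / (16 * ((d : ℝ) + 1))) := by
    rw [neg_le_neg_iff]; exact one_div_le_one_div_of_le (by positivity) (by nlinarith only [hd1])
  have hγ1 : (-1 : ℝ) ≤ -(1 / (16 * ((d : ℝ) + 1))) := by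
    rw [neg_le_neg_iff]; rw [div_le_one (by positivity)]; nlinarith only [hd1]
  have hinv : ((L : ℝ) ^ i.kk)⁻¹ ≤ ((L : ℝ) ^ i.kk) ^ (-(1 / (16 * ((d : ℝ) + 1)))) := by
    rw [← Real.rpow_neg_one]; exact Real.rpow_le_rpow_of_exponent_le hx1 hγ1
  have h16 : ((L : ℝ) ^ i.kk) ^ (-(1 / 16 : ℝ)) ≤ ((L : ℝ) ^ i.kk) ^ (-(1 / (16 * ((d : ℝ) + 1)))) := Real.rpow_le_rpow_of_exponent_le hx1 hγ16
  have h8 : ((L : ℝ) ^ i.kk) ^ (-(1 / (8 * ((d : ℝ) + 1)))) ≤ ((L : ℝ) ^ i.kk) ^ (-(1 / (16 * ((d : ℝ) + 1)))) := Real.rpow_le_rpow_of_exponent_le hx1 hγ8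
  -- the class at the index: skewness and the C² window at scale `c₃₅L^mα₀`
  obtain ⟨hskew, h1, h2, h3⟩ := (sfInstance_reg335_iff d mm ι hL i c35 α₀ A').1 hA'
  have hconv : ((L : ℝ) ^ i.kk)⁻¹ * ((L : ℝ) ^ i.r)⁻¹ = (((L ^ i.r * L ^ i.kk : ℕ) : ℝ))⁻¹ := by
    push_cast
    rw [mul_inv, mul_comm]
  have hrA0 : 0 ≤ c35 * (L : ℝ) ^ i.m * α₀ := by positivity
  have hrAa : c35 * (L : ℝ) ^ i.m * α₀ ≤ c35 * a₁ := by
    rw [mul_assoc]; exact mul_le_mul_of_nonneg_left hMa hc35.le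
  have h2' : ∀ μ κ x', ‖A' μ (bshiftEquiv (cvM d L i.m i.kk hL) (L ^ i.r * L ^ i.kk) κ x') - A' μ x'‖ ≤ c35 * (L : ℝ) ^ i.m * α₀ * ((((L ^ i.r * L ^ i.kk : ℕ) : ℝ))⁻¹) :=
    fun μ κ x' => (h2 μ κ x').trans_eq (by rw [hconv])
  have h3' : ∀ μ κ x', ‖(A' μ (bshiftEquiv (cvM d L i.m i.kk hL) (L ^ i.r * L ^ i.kk) κ x') - A' μ x') -
      (A' μ (bshiftEquiv (cvM d L i.m i.kk hL) (L ^ i.r * L ^ i.kk) κ ((bshiftEquiv (cvM d L i.m i.kk hL) (L ^ i.r * L ^ i.kk) μ).symm x')) -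
        A' μ ((bshiftEquiv (cvM d L i.m i.kk hL) (L ^ i.r * L ^ i.kk) μ).symm x'))‖ ≤
      c35 * (L : ℝ) ^ i.m * α₀ * ((((L ^ i.r * L ^ i.kk : ℕ) : ℝ))⁻¹) * ((((L ^ i.r * L ^ i.kk : ℕ) : ℝ))⁻¹) :=
    fun μ κ x' => (h3 μ κ x').trans_eq (by rw [hconv])
  have hr2 : 2 * ((1 + Fintype.card (Fin (d + 1))) * ((3 + 2 * ((d : ℝ) + 1)) * (c35 * (L : ℝ) ^ i.m * α₀))) ≤ 1 := by
    have hWa : W * (c35 * a₁) ≤ 1 := by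
      calc W * (c35 * a₁) ≤ W * (c35 * aW) := mul_le_mul_of_nonneg_left (mul_le_mul_of_nonneg_left ha₁W hc35.le) hW0.le
        _ = 1 := by
          show W * (c35 * (1 / (W * c35))) = 1
          field_simp
    calc 2 * ((1 + Fintype.card (Fin (d + 1))) * ((3 + 2 * ((d : ℝ) + 1)) * (c35 * (L : ℝ) ^ i.m * α₀))) = W * (c35 * (L : ℝ) ^ i.m * α₀) := by ring
      _ ≤ W * (c35 * a₁) := mul_le_mul_of_nonneg_left hrAa hW0.le
      _ ≤ 1 := hWa
  have hscale : (14 * Real.exp 1 * (1 + Fintype.card (Fin (d + 1))) * basisConst e * ((1 + Fintype.card (Fin (d + 1))) * ((3 + 2 * ((d : ℝ) + 1)) * (c35 * (L : ℝ) ^ i.m * α₀)))) = σ * (c35 * (L : ℝ) ^ i.m * α₀) := by ring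
  have hSle : σ * (c35 * (L : ℝ) ^ i.m * α₀) ≤ σ * (c35 * a₁) := mul_le_mul_of_nonneg_left hrAa hσ0
  have hRle : (14 * Real.exp 1 * (1 + Fintype.card (Fin (d + 1))) * basisConst e * ((1 + Fintype.card (Fin (d + 1))) * ((3 + 2 * ((d : ℝ) + 1)) * (c35 * (L : ℝ) ^ i.m * α₀)))) * (1 + Fintype.card (Fin (d + 1) ⊕ Fin (d + 1))) ≤ Rm := by
    rw [hscale]
    have hRa : σ * (c35 * aR) * JJ ≤ Rm := by
      have hden : 0 < σ * c35 * JJ + 1 := by positivity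
      calc σ * (c35 * aR) * JJ = Rm * (σ * c35 * JJ) / (σ * c35 * JJ + 1) := by
            show σ * (c35 * (Rm / (σ * c35 * JJ + 1))) * JJ = Rm * (σ * c35 * JJ) / (σ * c35 * JJ + 1)
            field_simp
        _ ≤ Rm * (σ * c35 * JJ + 1) / (σ * c35 * JJ + 1) := by gcongr; linarith
        _ = Rm := by field_simp
    calc σ * (c35 * (L : ℝ) ^ i.m * α₀) * JJ ≤ σ * (c35 * a₁) * JJ := mul_le_mul_of_nonneg_right hSle hJJ0
      _ ≤ σ * (c35 * aR) * JJ := mul_le_mul_of_nonneg_right (mul_le_mul_of_nonneg_left (mul_le_mul_of_nonneg_left ha₁R hc35.le) hσ0) hJJ0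
      _ ≤ Rm := hRa
  have hRle₀ : (14 * Real.exp 1 * (1 + Fintype.card (Fin (d + 1))) * basisConst e * ((1 + Fintype.card (Fin (d + 1))) * ((3 + 2 * ((d : ℝ) + 1)) * (c35 * (L : ℝ) ^ i.m * α₀)))) * (1 + Fintype.card (Fin (d + 1) ⊕ Fin (d + 1))) ≤ R₀ := hRle.trans (min_le_left _ _)
  have hRle₀' : (14 * Real.exp 1 * (1 + Fintype.card (Fin (d + 1))) * basisConst e * ((1 + Fintype.card (Fin (d + 1))) * ((3 + 2 * ((d : ℝ) + 1)) * (c35 * (L : ℝ) ^ i.m * α₀)))) * (1 + Fintype.card (Fin (d + 1) ⊕ Fin (d + 1))) ≤ R₀' := hRle.trans (min_le_right _ _)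
  -- the common kernel of both defect families at the index
  have hSCJ0 : 0 ≤ (14 * Real.exp 1 * (1 + Fintype.card (Fin (d + 1))) * basisConst e * ((1 + Fintype.card (Fin (d + 1))) * ((3 + 2 * ((d : ℝ) + 1)) * (c35 * (L : ℝ) ^ i.m * α₀)))) * (1 + Fintype.card (Fin (d + 1) ⊕ Fin (d + 1))) * ((((L ^ i.kk : ℕ) : ℝ))⁻¹) := by positivity
  have hR2n : 0 ≤ ((((L ^ i.kk : ℕ) : ℝ)) ^ (-(1 / 16 : ℝ)) + (((L ^ i.kk : ℕ) : ℝ)) ^ (-(1 / (8 * ((d : ℝ) + 1)))) + (14 * Real.exp 1 * (1 + Fintype.card (Fin (d + 1))) * basisConst e * ((1 + Fintype.card (Fin (d + 1))) * ((3 + 2 * ((d : ℝ) + 1)) * (c35 * (L : ℝ) ^ i.m * α₀)))) * (1 + Fintype.card (Fin (d + 1) ⊕ Fin (d + 1))) * ((((L ^ i.kk : ℕ) : ℝ))⁻¹)) := by positivity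
  have hd0 : ∀ y y' : (sfGeo d hL i).Site, 0 ≤ (unitTorusGeo L i.kk (cvM d L i.m i.kk hL)).dist y y' := fun y y' => sfGeo_dist_nonneg d hL i y y'
  have hexp : ∀ (c : ℝ) (y y' : (sfGeo d hL i).Site), δm ≤ c → Real.exp (-(c * (unitTorusGeo L i.kk (cvM d L i.m i.kk hL)).dist y y')) ≤ Real.exp (-(δm * (unitTorusGeo L i.kk (cvM d L i.m i.kk hL)).dist y y')) :=
    fun c y y' hc => Real.exp_le_exp.mpr (neg_le_neg (mul_le_mul_of_nonneg_right hc (hd0 y y')))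
  -- slot 1: the covariant forward gradient η-defect (FILE 144), transferred to the sized carrier, weakened to the common kernel
  have key1 : ∀ ν : Fin (d + 1), HasMaj (BlockNorm.ofBlocks (sfGeo d hL i) (liftBlk (cvBlk d L i.m i.kk hL) ι))
      (BlockNorm.ofBlocks (sfGeo d hL i) (liftBlk (cvBlk d L i.m i.kk hL ∘ kingPrV L i.kk i.r (cvM d L i.m i.kk hL)) ι))
      (idef (pull (liftMap (kingPrV L i.kk i.r (cvM d L i.m i.kk hL)) ι)) (pull (liftMap (kingPrV L i.kk i.r (cvM d L i.m i.kk hL)) ι))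
          (covD ((((L ^ i.r * L ^ i.kk : ℕ) : ℝ))⁻¹) ((gaugePair (bshiftEquiv (cvM d L i.m i.kk hL) (L ^ i.r * L ^ i.kk)) (fun μ x' => coordMat e (ContinuousLinearMap.mulLeftRight ℝ (Matrix mm mm ℂ) (NormedSpace.exp (((((L ^ i.r * L ^ i.kk : ℕ) : ℝ))⁻¹) • A' μ x')) (NormedSpace.exp (((((L ^ i.r * L ^ i.kk : ℕ) : ℝ))⁻¹) • A' μ x'))ᴴ))) (Sum.inl ν)) ((bshiftEquiv (cvM d L i.m i.kk hL) (L ^ i.r * L ^ i.kk)) ν) ∘ₗ (cvGlued' d L i.m i.kk i.r hL a ((((L ^ i.r * L ^ i.kk : ℕ) : ℝ))⁻¹) ι e (fun _ _ => (1 : Matrix mm mm ℂ)) (fun μ x' => NormedSpace.exp (((((L ^ i.r * L ^ i.kk : ℕ) : ℝ))⁻¹) • A' μ x')) (cvNL' d L i.m i.kk i.r hL a ι) (fun _ => 0)))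
          (covD ((((L ^ i.kk : ℕ) : ℝ))⁻¹) ((gaugePair (bshiftEquiv (cvM d L i.m i.kk hL) (L ^ i.kk)) (fun μ x => coordMat e (ContinuousLinearMap.mulLeftRight ℝ (Matrix mm mm ℂ) (NormedSpace.exp (((((L ^ i.kk : ℕ) : ℝ))⁻¹) • gavgM (Matrix mm mm ℂ) (Fin (d + 1)) (kingPrV L i.kk i.r (cvM d L i.m i.kk hL)) A' μ x)) (NormedSpace.exp (((((L ^ i.kk : ℕ) : ℝ))⁻¹) • gavgM (Matrix mm mm ℂ) (Fin (d + 1)) (kingPrV L i.kk i.r (cvM d L i.m i.kk hL)) A' μ x))ᴴ))) (Sum.inl ν)) ((bshiftEquiv (cvM d L i.m i.kk hL) (L ^ i.kk)) ν) ∘ₗ (cvGlued d L i.m i.kk hL a ((((L ^ i.kk : ℕ) : ℝ))⁻¹) ι e (fun _ _ => (1 : Matrix mm mm ℂ)) (fun μ x => NormedSpace.exp (((((L ^ i.kk : ℕ) : ℝ))⁻¹) • gavgM (Matrix mm mm ℂ) (Fin (d + 1)) (kingPrV L i.kk i.r (cvM d L i.m i.kk hL)) A' μ x)) (cvNL d L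 i.m i.kk hL a ι) (fun _ => 0))))
      (fun y y' => Dm * ((((L ^ i.kk : ℕ) : ℝ)) ^ (-(1 / 16 : ℝ)) + (((L ^ i.kk : ℕ) : ℝ)) ^ (-(1 / (8 * ((d : ℝ) + 1)))) + (14 * Real.exp 1 * (1 + Fintype.card (Fin (d + 1))) * basisConst e * ((1 + Fintype.card (Fin (d + 1))) * ((3 + 2 * ((d : ℝ) + 1)) * (c35 * (L : ℝ) ^ i.m * α₀)))) * (1 + Fintype.card (Fin (d + 1) ⊕ Fin (d + 1))) * ((((L ^ i.kk : ℕ) : ℝ))⁻¹)) * Real.exp (-(δm * (unitTorusGeo L i.kk (cvM d L i.m i.kk hL)).dist y y'))) := fun ν =>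
    (hasMaj_unitTorusGeoS (d := d) (L := L) ((L : ℝ) ^ i.m) (H i.m i.kk i.r ν i.one_le hw₀ e he A' hskew (c35 * (L : ℝ) ^ i.m * α₀) hrA0 h1 h2' h3' hr2 hRle₀)).mono fun y y' => by
      refine mul_le_mul (mul_le_mul ((le_max_left D 0).trans (le_max_left _ _)) ?_ (by positivity) hDm0) (hexp _ y y' (min_le_left _ _)) (Real.exp_nonneg _) (mul_nonneg hDm0 hR2n)
      have : 0 ≤ (((L ^ i.kk : ℕ) : ℝ)) ^ (-(1 / (8 * ((d : ℝ) + 1)))) := by positivity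
      linarith only [this]
  -- slot 2: the adjoint covariant entry η-defect (n15-c∕179), likewise
  have key2 : ∀ ν : Fin (d + 1), HasMaj (BlockNorm.ofBlocks (sfGeo d hL i) (liftBlk (cvBlk d L i.m i.kk hL) ι))
      (BlockNorm.ofBlocks (sfGeo d hL i) (liftBlk (cvBlk d L i.m i.kk hL ∘ kingPrV L i.kk i.r (cvM d L i.m i.kk hL)) ι))
      (idef (pull (liftMap (kingPrV L i.kk i.r (cvM d L i.m i.kk hL)) ι)) (pull (liftMap (kingPrV L i.kk i.r (cvM d L i.m i.kk hL)) ι))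
            ((cvGlued' d L i.m i.kk i.r hL a ((((L ^ i.r * L ^ i.kk : ℕ) : ℝ))⁻¹) ι e (fun _ _ => (1 : Matrix mm mm ℂ)) (fun μ x' => NormedSpace.exp (((((L ^ i.r * L ^ i.kk : ℕ) : ℝ))⁻¹) • A' μ x')) (cvNL' d L i.m i.kk i.r hL a ι) (fun _ => 0)) ∘ₗ covD ((((L ^ i.r * L ^ i.kk : ℕ) : ℝ))⁻¹) ((gaugePair (bshiftEquiv (cvM d L i.m i.kk hL) (L ^ i.r * L ^ i.kk)) (fun μ x' => coordMat e (ContinuousLinearMap.mulLeftRight ℝ (Matrix mm mm ℂ) (NormedSpace.exp (((((L ^ i.r * L ^ i.kk : ℕ) : ℝ))⁻¹) • A' μ x')) (NormedSpace.exp (((((L ^ i.r * L ^ i.kk : ℕ) : ℝ))⁻¹) • A' μ x'))ᴴ))) (Sum.inr ν)) ((bshiftEquiv (cvM d L i.m i.kk hL) (L ^ i.r * L ^ i.kk)) ν).symm)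
            ((cvGlued d L i.m i.kk hL a ((((L ^ i.kk : ℕ) : ℝ))⁻¹) ι e (fun _ _ => (1 : Matrix mm mm ℂ)) (fun μ x => NormedSpace.exp (((((L ^ i.kk : ℕ) : ℝ))⁻¹) • gavgM (Matrix mm mm ℂ) (Fin (d + 1)) (kingPrV L i.kk i.r (cvM d L i.m i.kk hL)) A' μ x)) (cvNL d L i.m i.kk hL a ι) (fun _ => 0)) ∘ₗ covD ((((L ^ i.kk : ℕ) : ℝ))⁻¹) ((gaugePair (bshiftEquiv (cvM d L i.m i.kk hL) (L ^ i.kk)) (fun μ x => coordMat e (ContinuousLinearMap.mulLeftRight ℝ (Matrix mm mm ℂ) (NormedSpace.exp (((((L ^ i.kk : ℕ) : ℝ))⁻¹) • gavgM (Matrix mm mm ℂ) (Fin (d + 1)) (kingPrV L i.kk i.r (cvM d L i.m i.kk hL)) A' μ x)) (NormedSpace.exp (((((L ^ i.kk : ℕ) : ℝ))⁻¹) • gavgM (Matrix mm mm ℂ) (Fin (d + 1)) (kingPrV L i.kk i.r (cvM d L i.m i.kk hL)) A' μ x))ᴴ))) (Sum.inr ν)) ((bshiftEquiv (cvM d L i.m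 i.kk hL) (L ^ i.kk)) ν).symm))
      (fun y y' => Dm * ((((L ^ i.kk : ℕ) : ℝ)) ^ (-(1 / 16 : ℝ)) + (((L ^ i.kk : ℕ) : ℝ)) ^ (-(1 / (8 * ((d : ℝ) + 1)))) + (14 * Real.exp 1 * (1 + Fintype.card (Fin (d + 1))) * basisConst e * ((1 + Fintype.card (Fin (d + 1))) * ((3 + 2 * ((d : ℝ) + 1)) * (c35 * (L : ℝ) ^ i.m * α₀)))) * (1 + Fintype.card (Fin (d + 1) ⊕ Fin (d + 1))) * ((((L ^ i.kk : ℕ) : ℝ))⁻¹)) * Real.exp (-(δm * (unitTorusGeo L i.kk (cvM d L i.m i.kk hL)).dist y y'))) := fun ν =>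
    (hasMaj_unitTorusGeoS (d := d) (L := L) ((L : ℝ) ^ i.m) (H' i.m i.kk i.r ν i.one_le hw₀' e he A' hskew (c35 * (L : ℝ) ^ i.m * α₀) hrA0 h1 h2' h3' hr2 hRle₀')).mono fun y y' =>
      mul_le_mul (mul_le_mul_of_nonneg_right ((le_max_left D' 0).trans (le_max_right _ _)) hR2n) (hexp _ y y' (min_le_right _ _)) (Real.exp_nonneg _) (mul_nonneg hDm0 hR2n)
  -- the scalar comparison of the common kernel with the consumer's kernel (as in 132's entry 0), rate exponent `γ = 1∕(16(d+1))`
  have hscal : ∀ y y' : (sfGeo d hL i).Site, Dm * ((((L ^ i.kk : ℕ) : ℝ)) ^ (-(1 / 16 : ℝ)) + (((L ^ i.kk : ℕ) : ℝ)) ^ (-(1 / (8 * ((d : ℝ) + 1)))) + (14 * Real.exp 1 * (1 + Fintype.card (Fin (d + 1))) * basisConst e * ((1 + Fintype.card (Fin (d + 1))) * ((3 + 2 * ((d : ℝ) + 1)) * (c35 * (L : ℝ) ^ i.m * α₀)))) * (1 + Fintype.card (Fin (d + 1) ⊕ Fin (d + 1))) * ((((L ^ i.kk : ℕ) : ℝ))⁻¹))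 * Real.exp (-(δm * (unitTorusGeo L i.kk (cvM d L i.m i.kk hL)).dist y y')) ≤
      B₁ * B9.pref4 ((opGeo (sfGeo d hL i) (CvX d L i.m i.kk hL × ι) (liftBlk (cvBlk d L i.m i.kk hL) ι)).len y) n * Real.exp (-(δm * (sfGeo d hL i).dist y y')) *
        max (rateFactor (opGeo (sfGeo d hL i) (CvX d L i.m i.kk hL × ι) (liftBlk (cvBlk d L i.m i.kk hL) ι)) (1 / (16 * ((d : ℝ) + 1))) y)
          (rateFactor (opGeo (sfGeo d hL i) (CvX d L i.m i.kk hL × ι) (liftBlk (cvBlk d L i.m i.kk hL) ι)) (1 / (16 * ((d : ℝ) + 1))) y') := fun y y' => by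
    rw [opGeo_len, sfGeo_len d hL i y, hrf y (1 / (16 * ((d : ℝ) + 1))), hrf y' (1 / (16 * ((d : ℝ) + 1))), max_self, hcast]
    have hpref : B9.pref4 (1 : ℝ) n = 1 := by fin_cases n <;> simp [B9.pref4]
    rw [hpref, mul_one]
    have hE0 : 0 ≤ Real.exp (-(δm * (unitTorusGeo L i.kk (cvM d L i.m i.kk hL)).dist y y')) := Real.exp_nonneg _
    have hrpos : 0 ≤ ((L : ℝ) ^ i.kk) ^ (-(1 / (16 * ((d : ℝ) + 1)))) := Real.rpow_nonneg hxpos.le _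
    have hbr : ((L : ℝ) ^ i.kk) ^ (-(1 / 16 : ℝ)) + ((L : ℝ) ^ i.kk) ^ (-(1 / (8 * ((d : ℝ) + 1)))) + σ * (c35 * (L : ℝ) ^ i.m * α₀) * (1 + Fintype.card (Fin (d + 1) ⊕ Fin (d + 1))) * ((L : ℝ) ^ i.kk)⁻¹ ≤
        (2 + σ * (c35 * a₁) * JJ) * ((L : ℝ) ^ i.kk) ^ (-(1 / (16 * ((d : ℝ) + 1)))) := by
      have hB : σ * (c35 * (L : ℝ) ^ i.m * α₀) * (1 + Fintype.card (Fin (d + 1) ⊕ Fin (d + 1))) * ((L : ℝ) ^ i.kk)⁻¹ ≤ σ * (c35 * a₁) * JJ * ((L : ℝ) ^ i.kk) ^ (-(1 / (16 * ((d : ℝ) + 1)))) :=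
        mul_le_mul (mul_le_mul_of_nonneg_right hSle hJJ0) hinv (by positivity) (by positivity)
      nlinarith only [hB, h16, h8]
    calc Dm * (((L : ℝ) ^ i.kk) ^ (-(1 / 16 : ℝ)) + ((L : ℝ) ^ i.kk) ^ (-(1 / (8 * ((d : ℝ) + 1)))) + (14 * Real.exp 1 * (1 + Fintype.card (Fin (d + 1))) * basisConst e * ((1 + Fintype.card (Fin (d + 1))) * ((3 + 2 * ((d : ℝ) + 1)) * (c35 * (L : ℝ) ^ i.m * α₀)))) * (1 + Fintype.card (Fin (d + 1) ⊕ Fin (d + 1))) * (((L : ℝ) ^ i.kk)⁻¹)) *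
          Real.exp (-(δm * (unitTorusGeo L i.kk (cvM d L i.m i.kk hL)).dist y y'))
        ≤ Dm * ((2 + σ * (c35 * a₁) * JJ) * ((L : ℝ) ^ i.kk) ^ (-(1 / (16 * ((d : ℝ) + 1))))) * Real.exp (-(δm * (unitTorusGeo L i.kk (cvM d L i.m i.kk hL)).dist y y')) := by
          rw [hscale]
          exact mul_le_mul_of_nonneg_right (mul_le_mul_of_nonneg_left hbr hDm0) hE0
      _ = (Dm * (2 + σ * (c35 * a₁) * JJ)) * Real.exp (-(δm * (sfGeo d hL i).dist y y')) * ((L : ℝ) ^ i.kk) ^ (-(1 / (16 * ((d : ℝ) + 1)))) := by ring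
      _ ≤ B₁ * Real.exp (-(δm * (sfGeo d hL i).dist y y')) * ((L : ℝ) ^ i.kk) ^ (-(1 / (16 * ((d : ℝ) + 1)))) := by
          refine mul_le_mul_of_nonneg_right (mul_le_mul_of_nonneg_right ?_ (Real.exp_nonneg _)) hrpos
          show Dm * (2 + σ * (c35 * a₁) * JJ) ≤ Dm * (2 + σ * (c35 * a₁) * JJ) + 1
          linarith
  -- which entry: `n ∈ {1, 2}` picks its pinning equation and its key
  have hn : n = 1 ∨ n = 2 := by
    rcases n with ⟨n, hn⟩
    simp only [ne_eq, Fin.ext_iff, Fin.val_zero] at hn0 hn3 ⊢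
    simp only [show ((3 : Fin 4) : ℕ) = 3 from rfl] at hn3
    simp only [show ((1 : Fin 4) : ℕ) = 1 from rfl, show ((2 : Fin 4) : ℕ) = 2 from rfl]
    omega
  rcases hn with rfl | rfl
  · rw [hE1 i A']
    exact (key1 μ₁).mono fun y y' => hscal y y'
  · rw [hE2 i A']
    exact (key2 μ₂).mono fun y y' => hscal y y'

end Summit.QuantumFields.YangMills.BalabanUVNodes.N15.Gluing

end
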